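import Literature.MathematicalPhysics.QuantumFieldTheory.OSLogSlotSector
import Literature.MathematicalPhysics.QuantumFieldTheory.OSContinuationBounds
import HarnessLib

/-!
# Sector continuation of functions of polynomial growth on the open orthant, and the maximum principle on the flat tubes

Topic `Literature/MathematicalPhysics/QuantumFieldTheory`; support file (all proved; one
`Prop`-valued hypothesis bundle and four auxiliary definitions; no named facts) for the discharge
of (A1) `OS1975_exists_timeContinuation`. Osterwalder–Schrader II (Comm. Math. Phys. 42 (1975)):
Ch. V (5.4), (5.7)–(5.8) — the step (A₀), (P₀) ⇒ (A₁), *"by (5.4) … the right hand side of (5.7)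
can be analytically continued to `ℂ₊` in each of the variables (one at a time) … it follows now from
the Malgrange–Zerner theorem … that there is an analytic function … analytic in
`{w | ∑ |arg wᵢ| < π/2}`"* — and Ch. VI.2 (6.15)/(6.28) at `N = 0 → 1`, *"we can use the maximum
principle (see (6.15) and e.g. Vladimirov p. 178), to conclude that (6.28) holds for `N = M + 1`"*.
The engine `LogSlot.exists_holomorphic_extension_sectorRegion` (`OSLogSlotSector`) wants a function
continuous and polynomially bounded on the *closed* orthant; the unregularised Schwinger functions
blow up at its boundary (OS (4.5): like `(min ξᵢ)^{-N}`) and their slot continuations blow up at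
the edge of the sector. Here this is repaired by a holomorphic damping, and the maximum principle on
the flat tubes is derived from the engine itself:

* `IsSectorData a S E C₀ p Csec` — the hypotheses: `S` continuous on the open orthant with
  `‖S u‖ ≤ C₀ Π(u)ᵖ` (`Π(u) = ∏ (uⱼ + uⱼ⁻¹)`), slot functions `Eᵢ(u', ·)` holomorphic on the open
  sector of opening `a ≤ π/2`, continuous in `u'` on the open orthant, bounded by
  `Csec(c) Π(u')ᵖ (|τ| + |τ|⁻¹)ᵖ` on the closed sub-sectors `{|arg τ| ≤ c}`, `c < a`, and equal to
  `S` on the positive axis;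
* `dR`, `dC`, `dampS`, `dampE` — the damping `t ↦ t/(1+t)²` (holomorphic, nonvanishing on
  `{Re > 0}`, `|dC τ| (|τ| + |τ|⁻¹) ≤ 1`), and the damped data, continuous and bounded on the closed
  orthant / closed sectors as the engine requires;
* `IsSectorData.exists_extension` — **(5.8) with opening `a`**: `G` holomorphic on the sector region
  `{Re wⱼ > 0, ∑ⱼ |arg wⱼ| < a}` with `G = S` at the positive real points;
* `IsSectorData.extension_insertNth` — on the flat tubes the extension *is* the slot continuation:
  `G(u₀, …, τ, …, u_m) = Eᵢ(u', τ)` (identity theorem in one variable);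
* `IsSectorData.norm_extension_le` — **the maximum principle on the flat tubes**: if `‖S‖ ≤ M` on the
  orthant and `‖Eᵢ(u', τ)‖ ≤ M` for `|arg τ| ≤ c` (`0 < c < a`), then `‖G w‖ ≤ M` on
  `{∑ⱼ |arg wⱼ| < c}` (else, with `v = G(w₀)`, `|v| > M`, the data `1/(S − v)`, `1/(Eᵢ − v)` extend
  by the first theorem to `g̃` with `(G − v) g̃ = 1` at the real points, hence everywhere — impossible
  at `w₀`; this is the envelope-of-holomorphy maximum principle OS cite from Vladimirov, here without
  any a priori growth hypothesis on `G`).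

## References

* K. Osterwalder, R. Schrader, *Axioms for Euclidean Green's functions II*, Comm. Math. Phys.
  42 (1975) 281–305, Ch. V (5.4), (5.7)–(5.8); Ch. VI.2 (6.15), (6.20), (6.28). [OsterwalderSchraderCMP1975]
* V. S. Vladimirov, *Methods of the theory of functions of many complex variables*, MIT Press 1966,
  p. 178 (maximum principle on envelopes of holomorphy).
-/

noncomputable section

open MeasureTheory Set Filter Real
open _root_.Topology
open scoped NNReal SchwartzMap ContDiff

namespace Literature.MathematicalPhysics.QuantumFieldTheory.LogSlot

open Literature.Analysis.Complex Literature.MathematicalPhysics.QuantumFieldTheory.OSEnvelope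

/-! ### The damping -/

/-- The **real damping** `t ↦ t/(1+t)²`. [folklore] -/
def dR (t : ℝ) : ℝ := t / (1 + t) ^ 2

/-- The **complex damping** `τ ↦ τ/(1+τ)²` (holomorphic and nonvanishing on `{Re τ > 0}`). [folklore] -/
def dC (τ : ℂ) : ℂ := τ / (1 + τ) ^ 2

/-- `dC` at real points. [folklore] -/
theorem dC_ofReal (t : ℝ) : dC (t : ℂ) = ((dR t : ℝ) : ℂ) := by
  simp only [dC, dR]; push_cast; ring

/-- `dR t > 0` for `t > 0`. [folklore] -/
theorem dR_pos {t : ℝ} (ht : 0 < t) : 0 < dR t := by unfold dR; positivity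

/-- `dR t ≤ t` for `t > 0`. [folklore] -/
theorem dR_le_self {t : ℝ} (ht : 0 < t) : dR t ≤ t := by
  unfold dR
  rw [div_le_iff₀ (by positivity)]
  exact le_mul_of_one_le_right ht.le (one_le_pow₀ (by linarith))

/-- **The damping beats one growth factor**: `dR t · (t + t⁻¹) ≤ 1` (`t > 0`). [folklore] -/
theorem dR_mul_le_one {t : ℝ} (ht : 0 < t) : dR t * (t + t⁻¹) ≤ 1 := by
  unfold dR
  have h1 : t / (1 + t) ^ 2 * (t + t⁻¹) = (t ^ 2 + 1) / (1 + t) ^ 2 := by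
    field_simp
  rw [h1, div_le_one (by positivity)]
  nlinarith

/-- `dR t ≤ 1` for `t > 0`. [folklore] -/
theorem dR_le_one {t : ℝ} (ht : 0 < t) : dR t ≤ 1 := by
  have h := dR_mul_le_one ht
  have h2 : 1 ≤ t + t⁻¹ := OSEnvelope.one_le_add_inv ht
  nlinarith [dR_pos ht]

/-- **Powers**: `dR t ^ (p+1) · (t + t⁻¹) ^ p ≤ dR t` (`t > 0`). [folklore] -/
theorem dR_pow_mul_pow_le {t : ℝ} (ht : 0 < t) (p : ℕ) : dR t ^ (p + 1) * (t + t⁻¹) ^ p ≤ dR t := by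
  rw [pow_succ, mul_assoc, mul_comm (dR t) ((t + t⁻¹) ^ p), ← mul_assoc, ← mul_pow]
  exact mul_le_of_le_one_left (dR_pos ht).le
    (pow_le_one₀ (mul_nonneg (dR_pos ht).le (by positivity)) (dR_mul_le_one ht))

/-- `dR` is continuous at every `t > -1`. [folklore] -/
theorem continuousAt_dR {t : ℝ} (ht : -1 < t) : ContinuousAt dR t := by
  unfold dR
  exact continuousAt_id.div ((continuousAt_const.add continuousAt_id).pow 2)
    (by have h1 : (0 : ℝ) < 1 + t := by linarith
        simpa using (pow_pos h1 2).ne')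

/-- **`dC` beats one growth factor on the closed right half-plane**: `‖dC τ‖ (|τ| + |τ|⁻¹) ≤ 1`. [folklore] -/
theorem norm_dC_mul_le_one {τ : ℂ} (hτ : 0 ≤ τ.re) : ‖dC τ‖ * (‖τ‖ + ‖τ‖⁻¹) ≤ 1 := by
  rcases eq_or_ne τ 0 with rfl | hne
  · simp [dC]
  have hn : 0 < ‖τ‖ := norm_pos_iff.2 hne
  have h1 : 1 + ‖τ‖ ^ 2 ≤ ‖1 + τ‖ ^ 2 := by
    rw [Complex.sq_norm, Complex.sq_norm, Complex.normSq_apply, Complex.normSq_apply]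
    simp only [Complex.add_re, Complex.one_re, Complex.add_im, Complex.one_im, zero_add]
    nlinarith
  have h1' : 0 < ‖1 + τ‖ ^ 2 := lt_of_lt_of_le (by positivity) h1
  rw [dC, norm_div, norm_pow]
  rw [div_mul_eq_mul_div, div_le_one h1']
  calc ‖τ‖ * (‖τ‖ + ‖τ‖⁻¹) = ‖τ‖ ^ 2 + 1 := by field_simp
    _ ≤ ‖1 + τ‖ ^ 2 := by linarith

/-- `‖dC τ‖ ≤ 1` on the closed right half-plane. [folklore] -/
theorem norm_dC_le_one {τ : ℂ} (hτ : 0 ≤ τ.re) : ‖dC τ‖ ≤ 1 := by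
  rcases eq_or_ne τ 0 with rfl | hne
  · simp [dC]
  have h := norm_dC_mul_le_one hτ
  have h2 : 1 ≤ ‖τ‖ + ‖τ‖⁻¹ := OSEnvelope.one_le_add_inv (norm_pos_iff.2 hne)
  nlinarith [norm_nonneg (dC τ)]

/-- **Powers**: `‖dC τ‖ ^ (p+1) · (|τ| + |τ|⁻¹) ^ p ≤ 1` on the closed right half-plane. [folklore] -/
theorem norm_dC_pow_mul_pow_le {τ : ℂ} (hτ : 0 ≤ τ.re) (p : ℕ) :
    ‖dC τ‖ ^ (p + 1) * (‖τ‖ + ‖τ‖⁻¹) ^ p ≤ 1 := by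
  rw [pow_succ, mul_assoc, mul_comm (‖dC τ‖) ((‖τ‖ + ‖τ‖⁻¹) ^ p), ← mul_assoc, ← mul_pow]
  exact mul_le_one₀ (pow_le_one₀ (by positivity) (norm_dC_mul_le_one hτ)) (norm_nonneg _)
    (norm_dC_le_one hτ)

/-- `dC τ ≠ 0` for `Re τ > 0`. [folklore] -/
theorem dC_ne_zero {τ : ℂ} (hτ : 0 < τ.re) : dC τ ≠ 0 := by
  have h1 : τ ≠ 0 := fun h => by rw [h] at hτ; simp at hτ
  have h2 : (1 + τ) ^ 2 ≠ 0 := pow_ne_zero _ fun h => by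
    have := congrArg Complex.re h; simp at this; linarith
  exact div_ne_zero h1 h2

/-- `dC` is holomorphic on `{Re τ > 0}`. [folklore] -/
theorem differentiableOn_dC : DifferentiableOn ℂ dC {τ : ℂ | 0 < τ.re} := fun τ hτ =>
  (differentiableAt_id.div ((differentiableAt_const _).add differentiableAt_id |>.pow 2)
    (pow_ne_zero _ fun h => by
      have := congrArg Complex.re h; simp at this; have : (0 : ℝ) < τ.re := hτ; linarith)).differentiableWithinAt

/-! ### The hypotheses -/

/-- **Sector data of opening `a`** for a function `S` of `m + 1` positive variables: `S` is continuous
on the open orthant with `‖S u‖ ≤ C₀ Π(u)ᵖ`; for every slot `i` the functions `Eᵢ(u', ·)` are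
holomorphic on the open sector `{Re τ > 0, |arg τ| < a}`, continuous in `u'` on the open orthant,
bounded by `Csec(c) Π(u')ᵖ (|τ| + |τ|⁻¹)ᵖ` on `{Re τ > 0, |arg τ| ≤ c}` for `c < a`, and
`Eᵢ(u', x) = S(u₀', …, x, …)` for `x > 0` (OS II: (A₀), the one-variable continuations (5.4), and
the bound (6.20)/(6.22) on closed sectors). [cite: OsterwalderSchraderCMP1975, Ch. V (5.4), (5.7); Ch. VI.2 (6.20), (6.22)] -/
structure IsSectorData {m : ℕ} (a : ℝ) (S : (Fin (m + 1) → ℝ) → ℂ) (E : Fin (m + 1) → (Fin m → ℝ) → ℂ → ℂ)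
    (C₀ : ℝ) (p : ℕ) (Csec : ℝ → ℝ) : Prop where
  cont : ContinuousOn S {u | ∀ j, 0 < u j}
  C₀_nonneg : 0 ≤ C₀
  bound : ∀ u : Fin (m + 1) → ℝ, (∀ j, 0 < u j) → ‖S u‖ ≤ C₀ * gFactor (fun j => (u j : ℂ)) ^ p
  slot_cont : ∀ (i : Fin (m + 1)) (τ : ℂ), τ ∈ openSector a →
    ContinuousOn (fun u' : Fin m → ℝ => E i u' τ) {u' | ∀ j, 0 < u' j}
  slot_holo : ∀ (i : Fin (m + 1)) (u' : Fin m → ℝ), (∀ j, 0 < u' j) → DifferentiableOn ℂ (E i u') (openSector a)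
  Csec_nonneg : ∀ c, 0 ≤ Csec c
  slot_bound : ∀ (i : Fin (m + 1)) (c : ℝ), c < a → ∀ (u' : Fin m → ℝ) (τ : ℂ), (∀ j, 0 < u' j) →
    0 < τ.re → |τ.arg| ≤ c →
      ‖E i u' τ‖ ≤ Csec c * gFactor (fun j => (u' j : ℂ)) ^ p * (‖τ‖ + ‖τ‖⁻¹) ^ p
  slot_real : ∀ (i : Fin (m + 1)) (u' : Fin m → ℝ), (∀ j, 0 < u' j) → ∀ x : ℝ, 0 < x →
    E i u' x = S (i.insertNth x u')

/-! ### The damped data -/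

section Damped

variable {m : ℕ} (a : ℝ) (p : ℕ) (S : (Fin (m + 1) → ℝ) → ℂ) (E : Fin (m + 1) → (Fin m → ℝ) → ℂ → ℂ)

open Classical in
/-- The **damped function** `(∏ⱼ dR(uⱼ)^{p+1}) S(u)` on the open orthant, `0` elsewhere. [folklore] -/
def dampS (u : Fin (m + 1) → ℝ) : ℂ :=
  if ∀ j, 0 < u j then (∏ j, ((dR (u j) : ℝ) : ℂ) ^ (p + 1)) * S u else 0

open Classical in
/-- The **damped slot functions** `(∏ⱼ dR(u'ⱼ)^{p+1}) dC(τ)^{p+1} Eᵢ(u', τ)` for `u'` in the open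
orthant and `τ` in the open sector, `0` elsewhere. [folklore] -/
def dampE (i : Fin (m + 1)) (u' : Fin m → ℝ) (τ : ℂ) : ℂ :=
  if (∀ j, 0 < u' j) ∧ τ ∈ openSector a then
    (∏ j, ((dR (u' j) : ℝ) : ℂ) ^ (p + 1)) * dC τ ^ (p + 1) * E i u' τ else 0

variable {a p S E}

/-- `Π` at a positive real point is the product of the real growth factors. [folklore] -/
theorem gFactor_ofReal {n : ℕ} {u : Fin n → ℝ} (hu : ∀ j, 0 < u j) :
    gFactor (fun j => (u j : ℂ)) = ∏ j, (u j + (u j)⁻¹) := by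
  unfold gFactor
  refine Finset.prod_congr rfl fun j _ => ?_
  rw [Complex.norm_real, Real.norm_eq_abs, abs_of_pos (hu j)]

/-- **The damping against the growth**: `(∏ⱼ dR(uⱼ)^{p+1}) Π(u)ᵖ ≤ ∏ⱼ dR(uⱼ)` on the open orthant. [folklore] -/
theorem prod_dR_pow_mul_gFactor_pow_le {n : ℕ} {u : Fin n → ℝ} (hu : ∀ j, 0 < u j) (p : ℕ) :
    (∏ j, dR (u j) ^ (p + 1)) * gFactor (fun j => (u j : ℂ)) ^ p ≤ ∏ j, dR (u j) := by
  rw [gFactor_ofReal hu, ← Finset.prod_pow, ← Finset.prod_mul_distrib]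
  exact Finset.prod_le_prod (fun j _ => mul_nonneg (pow_nonneg (dR_pos (hu j)).le _)
    (by have := hu j; positivity)) fun j _ => dR_pow_mul_pow_le (hu j) p

/-- A product of the dampings is at most any one of them. [folklore] -/
theorem prod_dR_le_single {n : ℕ} {u : Fin n → ℝ} (hu : ∀ j, 0 < u j) (j₀ : Fin n) :
    ∏ j, dR (u j) ≤ dR (u j₀) := by
  rw [← Finset.mul_prod_erase _ _ (Finset.mem_univ j₀)]
  exact mul_le_of_le_one_right (dR_pos (hu j₀)).le
    (Finset.prod_le_one (fun j _ => (dR_pos (hu j)).le) fun j _ => dR_le_one (hu j))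

/-- A product of the dampings is at most one. [folklore] -/
theorem prod_dR_le_one {n : ℕ} {u : Fin n → ℝ} (hu : ∀ j, 0 < u j) : ∏ j, dR (u j) ≤ 1 :=
  Finset.prod_le_one (fun j _ => (dR_pos (hu j)).le) fun j _ => dR_le_one (hu j)

/-- Norm of the complex product of the powers of the dampings. [folklore] -/
theorem norm_prod_dR_pow {n : ℕ} {u : Fin n → ℝ} (hu : ∀ j, 0 < u j) (p : ℕ) :
    ‖∏ j, ((dR (u j) : ℝ) : ℂ) ^ (p + 1)‖ = ∏ j, dR (u j) ^ (p + 1) := by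
  rw [norm_prod]
  refine Finset.prod_congr rfl fun j _ => ?_
  rw [norm_pow, Complex.norm_real, Real.norm_eq_abs, abs_of_pos (dR_pos (hu j))]

/-- **Bound of the damped function on the open orthant**: `‖dampS u‖ ≤ C₀ ∏ⱼ dR(uⱼ)`. [folklore] -/
theorem norm_dampS_le_prod {C₀ : ℝ} (hC₀ : 0 ≤ C₀)
    (hSb : ∀ u : Fin (m + 1) → ℝ, (∀ j, 0 < u j) → ‖S u‖ ≤ C₀ * gFactor (fun j => (u j : ℂ)) ^ p)
    {u : Fin (m + 1) → ℝ} (hu : ∀ j, 0 < u j) : ‖dampS p S u‖ ≤ C₀ * ∏ j, dR (u j) := by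
  rw [dampS, if_pos hu, norm_mul, norm_prod_dR_pow hu]
  calc (∏ j, dR (u j) ^ (p + 1)) * ‖S u‖ ≤ (∏ j, dR (u j) ^ (p + 1)) * (C₀ * gFactor (fun j => (u j : ℂ)) ^ p) :=
        mul_le_mul_of_nonneg_left (hSb u hu) (Finset.prod_nonneg fun j _ => pow_nonneg (dR_pos (hu j)).le _)
    _ = C₀ * ((∏ j, dR (u j) ^ (p + 1)) * gFactor (fun j => (u j : ℂ)) ^ p) := by ring
    _ ≤ C₀ * ∏ j, dR (u j) := mul_le_mul_of_nonneg_left (prod_dR_pow_mul_gFactor_pow_le hu p) hC₀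

/-- **The damped function is bounded by `C₀`** everywhere. [folklore] -/
theorem norm_dampS_le {C₀ : ℝ} (hC₀ : 0 ≤ C₀)
    (hSb : ∀ u : Fin (m + 1) → ℝ, (∀ j, 0 < u j) → ‖S u‖ ≤ C₀ * gFactor (fun j => (u j : ℂ)) ^ p)
    (u : Fin (m + 1) → ℝ) : ‖dampS p S u‖ ≤ C₀ * (1 + ‖u‖) ^ 0 := by
  rw [pow_zero, mul_one]
  by_cases hu : ∀ j, 0 < u j
  · exact (norm_dampS_le_prod hC₀ hSb hu).trans (mul_le_of_le_one_right hC₀ (prod_dR_le_one hu))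
  · rw [dampS, if_neg hu, norm_zero]; exact hC₀

/-- The open orthant is open. [folklore] -/
theorem isOpen_orthant (n : ℕ) : IsOpen {u : Fin n → ℝ | ∀ j, 0 < u j} := by
  have : {u : Fin n → ℝ | ∀ j, 0 < u j} = ⋂ j, {u | 0 < u j} := by ext u; simp
  rw [this]
  exact isOpen_iInter_of_finite fun j => isOpen_lt continuous_const (continuous_apply j)

/-- **Squeeze continuity at a zero.** [folklore] -/
theorem continuousAt_of_norm_le_tendsto {X : Type*} [TopologicalSpace X] {f : X → ℂ} {g : X → ℝ}
    {x₀ : X} (hf0 : f x₀ = 0) (hle : ∀ x, ‖f x‖ ≤ g x) (hg : Tendsto g (𝓝 x₀) (𝓝 0)) :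
    ContinuousAt f x₀ := by
  rw [ContinuousAt, hf0]
  exact squeeze_zero_norm hle hg

/-- **Continuity of the damped function on the whole space.** [folklore] -/
theorem continuous_dampS {C₀ : ℝ} (hC₀ : 0 ≤ C₀) (hSc : ContinuousOn S {u | ∀ j, 0 < u j})
    (hSb : ∀ u : Fin (m + 1) → ℝ, (∀ j, 0 < u j) → ‖S u‖ ≤ C₀ * gFactor (fun j => (u j : ℂ)) ^ p) :
    Continuous (dampS p S) := by
  refine continuous_iff_continuousAt.2 fun u₀ => ?_
  by_cases hu₀ : ∀ j, 0 < u₀ j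
  · -- on the open orthant: the product formula
    have hev : dampS p S =ᶠ[𝓝 u₀] fun u => (∏ j, ((dR (u j) : ℝ) : ℂ) ^ (p + 1)) * S u := by
      filter_upwards [(isOpen_orthant (m + 1)).mem_nhds hu₀] with u hu
      rw [dampS, if_pos hu]
    refine (ContinuousAt.congr ?_ hev.symm)
    refine ContinuousAt.mul ?_ (hSc.continuousAt ((isOpen_orthant (m + 1)).mem_nhds hu₀))
    exact tendsto_finsetProd _ fun j _ =>
      ((Complex.continuous_ofReal.continuousAt.comp
        ((continuousAt_dR (by have := hu₀ j; linarith)).comp (continuous_apply j).continuousAt)).pow _)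
  · -- at the boundary: squeeze by `C₀ · max (u j₀) 0`
    push Not at hu₀
    obtain ⟨j₀, hj₀⟩ := hu₀
    have hf0 : dampS p S u₀ = 0 := by
      rw [dampS, if_neg]; push Not; exact ⟨j₀, hj₀⟩
    refine continuousAt_of_norm_le_tendsto hf0 (g := fun u => C₀ * max (u j₀) 0) (fun u => ?_) ?_
    · by_cases hu : ∀ j, 0 < u j
      · calc ‖dampS p S u‖ ≤ C₀ * ∏ j, dR (u j) := norm_dampS_le_prod hC₀ hSb hu
          _ ≤ C₀ * dR (u j₀) := mul_le_mul_of_nonneg_left (prod_dR_le_single hu j₀) hC₀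
          _ ≤ C₀ * max (u j₀) 0 :=
              mul_le_mul_of_nonneg_left ((dR_le_self (hu j₀)).trans (le_max_left _ _)) hC₀
      · rw [dampS, if_neg hu, norm_zero]; positivity
    · have h : Tendsto (fun u : Fin (m + 1) → ℝ => C₀ * max (u j₀) 0) (𝓝 u₀) (𝓝 (C₀ * max (u₀ j₀) 0)) :=
        ((continuous_apply j₀).max continuous_const).continuousAt.tendsto.const_mul C₀
      rwa [max_eq_right hj₀, mul_zero] at h

/-- **Bound of the damped slot functions on the closed sub-sectors**: `‖dampE i u' τ‖ ≤ Csec c`. [folklore] -/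
theorem norm_dampE_le {Csec : ℝ → ℝ} (hCsec : ∀ c, 0 ≤ Csec c)
    (hEb : ∀ (i : Fin (m + 1)) (c : ℝ), c < a → ∀ (u' : Fin m → ℝ) (τ : ℂ), (∀ j, 0 < u' j) →
      0 < τ.re → |τ.arg| ≤ c →
        ‖E i u' τ‖ ≤ Csec c * gFactor (fun j => (u' j : ℂ)) ^ p * (‖τ‖ + ‖τ‖⁻¹) ^ p)
    (i : Fin (m + 1)) {c : ℝ} (hc : c < a) (u' : Fin m → ℝ) {τ : ℂ} (hτ : 0 < τ.re) (hτc : |τ.arg| ≤ c) :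
    ‖dampE a p E i u' τ‖ ≤ Csec c * (1 + ‖u'‖) ^ 0 := by
  rw [pow_zero, mul_one, dampE]
  split_ifs with h
  · obtain ⟨hu, -⟩ := h
    rw [norm_mul, norm_mul, norm_prod_dR_pow hu, norm_pow]
    have hb := hEb i c hc u' τ hu hτ hτc
    have h1 : 0 ≤ ∏ j, dR (u' j) ^ (p + 1) := Finset.prod_nonneg fun j _ => pow_nonneg (dR_pos (hu j)).le _
    calc (∏ j, dR (u' j) ^ (p + 1)) * ‖dC τ‖ ^ (p + 1) * ‖E i u' τ‖
        ≤ (∏ j, dR (u' j) ^ (p + 1)) * ‖dC τ‖ ^ (p + 1) *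
            (Csec c * gFactor (fun j => (u' j : ℂ)) ^ p * (‖τ‖ + ‖τ‖⁻¹) ^ p) :=
          mul_le_mul_of_nonneg_left hb (mul_nonneg h1 (by positivity))
      _ = Csec c * (((∏ j, dR (u' j) ^ (p + 1)) * gFactor (fun j => (u' j : ℂ)) ^ p) *
            (‖dC τ‖ ^ (p + 1) * (‖τ‖ + ‖τ‖⁻¹) ^ p)) := by ring
      _ ≤ Csec c * (1 * 1) := by
          refine mul_le_mul_of_nonneg_left (mul_le_mul ((prod_dR_pow_mul_gFactor_pow_le hu p).trans
            (prod_dR_le_one hu)) (norm_dC_pow_mul_pow_le hτ.le p) (by positivity) zero_le_one) (hCsec c)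
      _ = Csec c := by ring
  · rw [norm_zero]; exact hCsec c

/-- **Continuity of the damped slot functions in the parameters, on the whole space.** [folklore] -/
theorem continuous_dampE {Csec : ℝ → ℝ} (hCsec : ∀ c, 0 ≤ Csec c)
    (hEc : ∀ (i : Fin (m + 1)) (τ : ℂ), τ ∈ openSector a →
      ContinuousOn (fun u' : Fin m → ℝ => E i u' τ) {u' | ∀ j, 0 < u' j})
    (hEb : ∀ (i : Fin (m + 1)) (c : ℝ), c < a → ∀ (u' : Fin m → ℝ) (τ : ℂ), (∀ j, 0 < u' j) →
      0 < τ.re → |τ.arg| ≤ c →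
        ‖E i u' τ‖ ≤ Csec c * gFactor (fun j => (u' j : ℂ)) ^ p * (‖τ‖ + ‖τ‖⁻¹) ^ p)
    (i : Fin (m + 1)) (τ : ℂ) : Continuous fun u' : Fin m → ℝ => dampE a p E i u' τ := by
  by_cases hτ : τ ∈ openSector a
  swap
  · have : (fun u' : Fin m → ℝ => dampE a p E i u' τ) = fun _ => 0 := by
      funext u'; rw [dampE, if_neg]; exact fun h => hτ h.2
    rw [this]; exact continuous_const
  refine continuous_iff_continuousAt.2 fun u₀ => ?_
  by_cases hu₀ : ∀ j, 0 < u₀ j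
  · have hev : (fun u' : Fin m → ℝ => dampE a p E i u' τ) =ᶠ[𝓝 u₀] fun u' =>
        (∏ j, ((dR (u' j) : ℝ) : ℂ) ^ (p + 1)) * dC τ ^ (p + 1) * E i u' τ := by
      filter_upwards [(isOpen_orthant m).mem_nhds hu₀] with u hu
      rw [dampE, if_pos ⟨hu, hτ⟩]
    refine ContinuousAt.congr ?_ hev.symm
    refine ContinuousAt.mul (ContinuousAt.mul ?_ continuousAt_const)
      ((hEc i τ hτ).continuousAt ((isOpen_orthant m).mem_nhds hu₀))
    exact tendsto_finsetProd _ fun j _ =>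
      ((Complex.continuous_ofReal.continuousAt.comp
        ((continuousAt_dR (by have := hu₀ j; linarith)).comp (continuous_apply j).continuousAt)).pow _)
  · push Not at hu₀
    obtain ⟨j₀, hj₀⟩ := hu₀
    have hf0 : dampE a p E i u₀ τ = 0 := by
      rw [dampE, if_neg]; push Not; exact fun h => absurd (h j₀) (not_lt.2 hj₀)
    -- the bound through the sector constant at `c = |arg τ|`
    set c : ℝ := |τ.arg| with hc
    have hca : c < a := hτ.2
    set K : ℝ := Csec c with hK
    have hK0 : 0 ≤ K := hCsec c
    refine continuousAt_of_norm_le_tendsto hf0 (g := fun u' => K * max (u' j₀) 0) (fun u' => ?_) ?_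
    · by_cases hu : ∀ j, 0 < u' j
      · rw [dampE, if_pos ⟨hu, hτ⟩, norm_mul, norm_mul, norm_prod_dR_pow hu, norm_pow]
        have hb := hEb i c hca u' τ hu hτ.1 le_rfl
        have h1 : 0 ≤ ∏ j, dR (u' j) ^ (p + 1) := Finset.prod_nonneg fun j _ => pow_nonneg (dR_pos (hu j)).le _
        calc (∏ j, dR (u' j) ^ (p + 1)) * ‖dC τ‖ ^ (p + 1) * ‖E i u' τ‖
            ≤ (∏ j, dR (u' j) ^ (p + 1)) * ‖dC τ‖ ^ (p + 1) *
                (Csec c * gFactor (fun j => (u' j : ℂ)) ^ p * (‖τ‖ + ‖τ‖⁻¹) ^ p) :=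
              mul_le_mul_of_nonneg_left hb (mul_nonneg h1 (by positivity))
          _ = K * (((∏ j, dR (u' j) ^ (p + 1)) * gFactor (fun j => (u' j : ℂ)) ^ p) *
                (‖dC τ‖ ^ (p + 1) * (‖τ‖ + ‖τ‖⁻¹) ^ p)) := by rw [hK]; ring
          _ ≤ K * (max (u' j₀) 0 * 1) := by
              refine mul_le_mul_of_nonneg_left (mul_le_mul ?_ (norm_dC_pow_mul_pow_le hτ.1.le p)
                (by positivity) (le_max_right _ _)) hK0
              exact ((prod_dR_pow_mul_gFactor_pow_le hu p).trans (prod_dR_le_single hu j₀)).trans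
                ((dR_le_self (hu j₀)).trans (le_max_left _ _))
          _ = K * max (u' j₀) 0 := by ring
      · rw [dampE, if_neg (fun h => hu h.1), norm_zero]; positivity
    · have h : Tendsto (fun u' : Fin m → ℝ => K * max (u' j₀) 0) (𝓝 u₀) (𝓝 (K * max (u₀ j₀) 0)) :=
        ((continuous_apply j₀).max continuous_const).continuousAt.tendsto.const_mul K
      rwa [max_eq_right hj₀, mul_zero] at h

/-- **Holomorphy of the damped slot functions on the open sector.** [folklore] -/
theorem differentiableOn_dampE
    (hEd : ∀ (i : Fin (m + 1)) (u' : Fin m → ℝ), (∀ j, 0 < u' j) → DifferentiableOn ℂ (E i u') (openSector a))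
    (i : Fin (m + 1)) (u' : Fin m → ℝ) : DifferentiableOn ℂ (dampE a p E i u') (openSector a) := by
  by_cases hu : ∀ j, 0 < u' j
  · have heq : EqOn (dampE a p E i u')
        (fun τ => (∏ j, ((dR (u' j) : ℝ) : ℂ) ^ (p + 1)) * dC τ ^ (p + 1) * E i u' τ) (openSector a) := by
      intro τ hτ; rw [dampE, if_pos ⟨hu, hτ⟩]
    refine DifferentiableOn.congr ?_ heq
    exact (((differentiableOn_const _).mul ((differentiableOn_dC.mono fun τ hτ => hτ.1).pow _)).mul
      (hEd i u' hu))
  · have : dampE a p E i u' = fun _ => 0 := by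
      funext τ; rw [dampE, if_neg (fun h => hu h.1)]
    rw [this]; exact differentiableOn_const _

/-- **The damped slot functions restrict to the damped function on the nonnegative axis.** [folklore] -/
theorem dampE_real (ha0 : 0 < a)
    (hES : ∀ (i : Fin (m + 1)) (u' : Fin m → ℝ), (∀ j, 0 < u' j) → ∀ x : ℝ, 0 < x → E i u' x = S (i.insertNth x u'))
    (i : Fin (m + 1)) (u' : Fin m → ℝ) (x : ℝ) (hx : 0 ≤ x) :
    dampE a p E i u' x = dampS p S (i.insertNth x u') := by
  by_cases h : (∀ j, 0 < u' j) ∧ 0 < x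
  · obtain ⟨hu, hx0⟩ := h
    have hxsec : (x : ℂ) ∈ openSector a := ⟨by simpa using hx0, by
      rw [Complex.arg_ofReal_of_nonneg hx, abs_zero]; exact ha0⟩
    have hall : ∀ j, 0 < (i.insertNth x u' : Fin (m + 1) → ℝ) j := by
      intro j
      refine Fin.succAboveCases i ?_ (fun j' => ?_) j
      · rwa [Fin.insertNth_apply_same]
      · rw [Fin.insertNth_apply_succAbove]; exact hu j'
    rw [dampE, if_pos ⟨hu, hxsec⟩, dampS, if_pos hall, hES i u' hu x hx0, dC_ofReal,
      Fin.prod_univ_succAbove _ i, Fin.insertNth_apply_same]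
    simp only [Fin.insertNth_apply_succAbove]
    ring
  · have hE : dampE a p E i u' x = 0 := by
      rw [dampE, if_neg]
      rintro ⟨hu, hxs⟩
      exact h ⟨hu, by simpa using hxs.1⟩
    have hS : dampS p S (i.insertNth x u') = 0 := by
      rw [dampS, if_neg]
      intro hall
      apply h
      refine ⟨fun j => ?_, ?_⟩
      · have := hall (i.succAbove j); rwa [Fin.insertNth_apply_succAbove] at this
      · have := hall i; rwa [Fin.insertNth_apply_same] at this
    rw [hE, hS]

end Damped

/-! ### The continuation to the sector region -/

/-- Differentiability of a finite product of functions on a normed space. [folklore] -/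
theorem differentiableOn_finset_prod_fun {X : Type*} [NormedAddCommGroup X] [NormedSpace ℂ X] {ι : Type*}
    (u : Finset ι) {f : ι → X → ℂ} {s : Set X} (h : ∀ i ∈ u, DifferentiableOn ℂ (f i) s) :
    DifferentiableOn ℂ (fun x => ∏ i ∈ u, f i x) s := by
  classical
  induction u using Finset.induction_on with
  | empty => simp only [Finset.prod_empty]; exact differentiableOn_const _
  | insert a u ha ih =>
    simp only [Finset.prod_insert ha]
    exact (h a (Finset.mem_insert_self a u)).mul (ih fun i hi => h i (Finset.mem_insert_of_mem hi))

section Extension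

variable {m : ℕ} {a : ℝ} {S : (Fin (m + 1) → ℝ) → ℂ} {E : Fin (m + 1) → (Fin m → ℝ) → ℂ → ℂ}
  {C₀ : ℝ} {p : ℕ} {Csec : ℝ → ℝ}

/-- **Osterwalder–Schrader's (5.8) for functions of polynomial growth on the open orthant**: sector
data of opening `a` (`0 < a ≤ π/2`) have a holomorphic continuation `G` to the sector region
`{Re wⱼ > 0, ∑ⱼ |arg wⱼ| < a}`, `G(u) = S(u)` at every positive real point (damp, apply
`exists_holomorphic_extension_sectorRegion` with the window `b = 1`, undo the damping). [cite: OsterwalderSchraderCMP1975, Ch. V eqs. (5.4), (5.7)–(5.8)] -/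
theorem IsSectorData.exists_extension (h : IsSectorData a S E C₀ p Csec) (ha0 : 0 < a) (ha : a ≤ π / 2) :
    ∃ G : (Fin (m + 1) → ℂ) → ℂ, DifferentiableOn ℂ G (sectorRegion m a) ∧
      ∀ u : Fin (m + 1) → ℝ, (∀ j, 0 < u j) → G (fun j => (u j : ℂ)) = S u := by
  obtain ⟨G₀, hG₀, hG₀real⟩ := exists_holomorphic_extension_sectorRegion (dampS p S) (dampE a p E)
    (b := 1) one_pos ha0 ha (continuous_dampS h.C₀_nonneg h.cont h.bound) (norm_dampS_le h.C₀_nonneg h.bound)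
    (continuous_dampE h.Csec_nonneg h.slot_cont h.slot_bound)
    (differentiableOn_dampE h.slot_holo) (fun _ c => Csec c) (fun _ => 0) (fun _ c => h.Csec_nonneg c)
    (fun i c hc u' τ hτ hτc => norm_dampE_le h.Csec_nonneg h.slot_bound i hc u' hτ hτc)
    (fun i u' _ x hx => dampE_real ha0 h.slot_real i u' x hx)
  -- undo the damping
  set D : (Fin (m + 1) → ℂ) → ℂ := fun w => ∏ j, dC (w j) ^ (p + 1) with hD
  have hDd : DifferentiableOn ℂ D (sectorRegion m a) :=
    differentiableOn_finset_prod_fun _ fun j _ => DifferentiableOn.pow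
      (differentiableOn_dC.comp (differentiableOn_pi.1 differentiableOn_id j) fun w hw => hw.1 j) _
  have hDne : ∀ w ∈ sectorRegion m a, D w ≠ 0 := fun w hw =>
    Finset.prod_ne_zero_iff.2 fun j _ => pow_ne_zero _ (dC_ne_zero (hw.1 j))
  refine ⟨fun w => G₀ w * (D w)⁻¹, hG₀.mul (hDd.inv hDne), fun u hu => ?_⟩
  have hDu : D (fun j => (u j : ℂ)) = ∏ j, ((dR (u j) : ℝ) : ℂ) ^ (p + 1) := by
    simp only [hD, dC_ofReal]
  have hPne : (∏ j, ((dR (u j) : ℝ) : ℂ) ^ (p + 1)) ≠ 0 :=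
    Finset.prod_ne_zero_iff.2 fun j _ => pow_ne_zero _ (by exact_mod_cast (dR_pos (hu j)).ne')
  show G₀ (fun j => (u j : ℂ)) * (D (fun j => (u j : ℂ)))⁻¹ = S u
  rw [hG₀real u hu, dampS, if_pos hu, hDu, mul_assoc, mul_comm (S u), ← mul_assoc, mul_inv_cancel₀ hPne,
    one_mul]

/-! ### The extension on the flat tubes is the slot continuation -/

/-- **Identity theorem on a horizontal strip from the real axis.** [folklore] -/
theorem eqOn_strip_of_eqOn_real {f g : ℂ → ℂ} {a : ℝ} (hf : DifferentiableOn ℂ f {z : ℂ | |z.im| < a})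
    (hg : DifferentiableOn ℂ g {z : ℂ | |z.im| < a}) (hfg : ∀ t : ℝ, f t = g t) :
    EqOn f g {z : ℂ | |z.im| < a} := by
  rcases le_or_gt a 0 with ha | ha
  · intro z hz; exact absurd hz (by simp only [mem_setOf_eq, not_lt]; exact ha.trans (abs_nonneg _))
  set O : Set ℂ := {z : ℂ | |z.im| < a} with hO
  have hO' : O = {z : ℂ | z.im < a} ∩ {z : ℂ | -a < z.im} := by
    ext z; simp only [hO, mem_setOf_eq, mem_inter_iff, abs_lt]; tauto
  have hOo : IsOpen O := by
    rw [hO']; exact (isOpen_lt Complex.continuous_im continuous_const).inter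
      (isOpen_lt continuous_const Complex.continuous_im)
  have hOc : IsPreconnected O := by
    rw [hO']; exact ((convex_halfSpace_im_lt a).inter (convex_halfSpace_im_gt (-a))).isPreconnected
  have h0 : ((0 : ℝ) : ℂ) ∈ O := by simp [hO, ha]
  have hfa : AnalyticOnNhd ℂ f O := hf.analyticOnNhd hOo
  have hga : AnalyticOnNhd ℂ g O := hg.analyticOnNhd hOo
  refine hfa.eqOn_of_preconnected_of_frequently_eq hga hOc h0 ?_
  have htend : Tendsto (fun t : ℝ => (t : ℂ)) (𝓝[≠] 0) (𝓝[≠] ((0 : ℝ) : ℂ)) := by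
    refine tendsto_nhdsWithin_of_tendsto_nhds_of_eventually_within _
      (Complex.continuous_ofReal.continuousAt.mono_left nhdsWithin_le_nhds) ?_
    filter_upwards [self_mem_nhdsWithin] with t ht
    simpa using ht
  have hev : ∀ᶠ t : ℝ in 𝓝[≠] 0, f t = g t := Eventually.of_forall hfg
  exact htend.frequently hev.frequently

/-- Inserting a point of the open sector into a positive real vector gives a point of the sector
region. [folklore] -/
theorem insertNth_mem_sectorRegion {i : Fin (m + 1)} {u' : Fin m → ℝ} (hu' : ∀ j, 0 < u' j) {τ : ℂ}
    (hτ : τ ∈ openSector a) : i.insertNth (α := fun _ => ℂ) τ (fun j => (u' j : ℂ)) ∈ sectorRegion m a := by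
  refine ⟨fun j => ?_, ?_⟩
  · refine Fin.succAboveCases i ?_ (fun j' => ?_) j
    · rw [Fin.insertNth_apply_same]; exact hτ.1
    · rw [Fin.insertNth_apply_succAbove]; simpa using hu' j'
  · rw [Fin.sum_univ_succAbove _ i, Fin.insertNth_apply_same]
    simp only [Fin.insertNth_apply_succAbove]
    have h0 : ∑ j, |Complex.arg (u' j : ℂ)| = 0 :=
      Finset.sum_eq_zero fun j _ => by rw [Complex.arg_ofReal_of_nonneg (hu' j).le, abs_zero]
    rw [h0, add_zero]
    exact hτ.2

/-- **On the flat tubes the continuation is the slot continuation**: if `G` is holomorphic on the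
sector region of opening `a ≤ π/2` and equal to `S` at the positive real points, then
`G(u₀', …, τ, …) = Eᵢ(u', τ)` for `u'` in the open orthant and `τ` in the open sector (both sides are
holomorphic in `log τ` on the strip `{|Im| < a}` and agree for real `τ > 0`). [cite: OsterwalderSchraderCMP1975, Ch. V eqs. (5.4), (5.7)] -/
theorem IsSectorData.extension_insertNth (h : IsSectorData a S E C₀ p Csec) (ha : a ≤ π / 2)
    {G : (Fin (m + 1) → ℂ) → ℂ} (hG : DifferentiableOn ℂ G (sectorRegion m a))
    (hGreal : ∀ u : Fin (m + 1) → ℝ, (∀ j, 0 < u j) → G (fun j => (u j : ℂ)) = S u)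
    (i : Fin (m + 1)) {u' : Fin m → ℝ} (hu' : ∀ j, 0 < u' j) {τ : ℂ} (hτ : τ ∈ openSector a) :
    G (i.insertNth (α := fun _ => ℂ) τ fun j => (u' j : ℂ)) = E i u' τ := by
  -- in the logarithmic variable
  set f : ℂ → ℂ := fun z => G (i.insertNth (α := fun _ => ℂ) (Complex.exp z) fun j => (u' j : ℂ)) with hf
  set g : ℂ → ℂ := fun z => E i u' (Complex.exp z) with hg
  have hins : Differentiable ℂ fun σ : ℂ => i.insertNth (α := fun _ => ℂ) σ fun j => (u' j : ℂ) := by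
    refine differentiable_pi.2 fun j => ?_
    refine Fin.succAboveCases i ?_ (fun j' => ?_) j
    · simp only [Fin.insertNth_apply_same]; exact differentiable_id
    · simp only [Fin.insertNth_apply_succAbove]; exact differentiable_const _
  have hfd : DifferentiableOn ℂ f {z : ℂ | |z.im| < a} := by
    refine hG.comp ((hins.comp Complex.differentiable_exp).differentiableOn) fun z hz => ?_
    exact insertNth_mem_sectorRegion hu' (exp_mem_openSector ha hz).1
  have hgd : DifferentiableOn ℂ g {z : ℂ | |z.im| < a} :=
    (h.slot_holo i u' hu').comp Complex.differentiable_exp.differentiableOn fun z hz => (exp_mem_openSector ha hz).1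
  have hfg : ∀ t : ℝ, f t = g t := by
    intro t
    simp only [hf, hg]
    rw [← Complex.ofReal_exp]
    have hins' : i.insertNth (α := fun _ => ℂ) ((Real.exp t : ℝ) : ℂ) (fun j => (u' j : ℂ)) =
        fun j => (((i.insertNth (Real.exp t) u' : Fin (m + 1) → ℝ) j : ℝ) : ℂ) := by
      funext j
      refine Fin.succAboveCases i ?_ (fun j' => ?_) j
      · simp only [Fin.insertNth_apply_same]
      · simp only [Fin.insertNth_apply_succAbove]
    rw [hins', hGreal _ (fun j => ?_), h.slot_real i u' hu' _ (Real.exp_pos t)]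
    refine Fin.succAboveCases i ?_ (fun j' => ?_) j
    · rw [Fin.insertNth_apply_same]; exact Real.exp_pos t
    · rw [Fin.insertNth_apply_succAbove]; exact hu' j'
  have heq := eqOn_strip_of_eqOn_real hfd hgd hfg
  -- back to `τ = exp (log τ)`
  have hτ0 : τ ≠ 0 := fun h0 => by rw [h0] at hτ; simp [openSector] at hτ
  have hlog : |(Complex.log τ).im| < a := by rw [Complex.log_im]; exact hτ.2
  have h1 := heq hlog
  simp only [hf, hg, Complex.exp_log hτ0] at h1
  exact h1

/-! ### The maximum principle on the flat tubes -/

/-- The sector region of opening `c` is the argument region over the `ℓ¹`-ball of radius `c`. [folklore] -/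
theorem sectorRegion_eq_setOf (m : ℕ) (c : ℝ) :
    sectorRegion m c = {ζ : Fin (m + 1) → ℂ | (∀ i, 0 < (ζ i).re) ∧
      (fun i => (ζ i).arg) ∈ {v : Fin (m + 1) → ℝ | ∑ i, |v i| < c}} := rfl

/-- The `ℓ¹`-ball is convex. [folklore] -/
theorem convex_l1Ball (n : ℕ) (c : ℝ) : Convex ℝ {v : Fin n → ℝ | ∑ i, |v i| < c} := by
  intro v hv w hw s t hs ht hst
  simp only [mem_setOf_eq] at hv hw ⊢
  calc ∑ i, |(s • v + t • w) i| ≤ ∑ i, (s * |v i| + t * |w i|) := Finset.sum_le_sum fun i _ => by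
          simp only [Pi.add_apply, Pi.smul_apply, smul_eq_mul]
          calc |s * v i + t * w i| ≤ |s * v i| + |t * w i| := abs_add_le _ _
            _ = s * |v i| + t * |w i| := by rw [abs_mul, abs_mul, abs_of_nonneg hs, abs_of_nonneg ht]
    _ = s * ∑ i, |v i| + t * ∑ i, |w i| := by rw [Finset.sum_add_distrib, Finset.mul_sum, Finset.mul_sum]
    _ < c := by
        rcases hs.eq_or_lt with rfl | hs'
        · rw [zero_add] at hst; rw [hst]; simpa using hw
        · calc s * ∑ i, |v i| + t * ∑ i, |w i| < s * c + t * c :=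
              add_lt_add_of_lt_of_le (mul_lt_mul_of_pos_left hv hs') (mul_le_mul_of_nonneg_left hw.le ht)
            _ = c := by rw [← add_mul, hst, one_mul]

/-- The `ℓ¹`-ball is open. [folklore] -/
theorem isOpen_l1Ball (n : ℕ) (c : ℝ) : IsOpen {v : Fin n → ℝ | ∑ i, |v i| < c} :=
  isOpen_lt (continuous_finsetSum _ fun i _ => (continuous_apply i).abs) continuous_const

/-- **Identity theorem on the sector region from the positive real points** (`0 < c ≤ π/2`). [cite: StreaterWightman1964, §2-3 (pdf p. 46)] -/
theorem eqOn_sectorRegion_of_eqOn_posReal {c : ℝ} (hc0 : 0 < c) (hc : c ≤ π / 2)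
    {f g : (Fin (m + 1) → ℂ) → ℂ} (hf : DifferentiableOn ℂ f (sectorRegion m c))
    (hg : DifferentiableOn ℂ g (sectorRegion m c))
    (hfg : ∀ η : Fin (m + 1) → ℝ, (∀ i, 0 < η i) → f (fun i => (η i : ℂ)) = g (fun i => (η i : ℂ))) :
    EqOn f g (sectorRegion m c) := by
  rw [sectorRegion_eq_setOf] at hf hg ⊢
  refine eqOn_argRegion_of_eqOn_posReal (isOpen_l1Ball _ c) (convex_l1Ball _ c) (by simpa using hc0)
    (fun v hv i => ?_) hf hg hfg
  have h1 : |v i| ≤ ∑ j, |v j| := Finset.single_le_sum (f := fun j => |v j|) (fun j _ => abs_nonneg _)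
    (Finset.mem_univ i)
  exact lt_of_le_of_lt h1 (lt_of_lt_of_le hv hc)

/-- **The maximum principle on the flat tubes** (OS II (6.15) at the first step, Vladimirov p. 178):
let `G` be holomorphic on the sector region of opening `a ≤ π/2` and equal to `S` at the positive real
points, for sector data `(S, E)` of opening `a`. If `‖S u‖ ≤ M` on the open orthant and
`‖Eᵢ(u', τ)‖ ≤ M` for `u'` in the open orthant and `Re τ > 0`, `|arg τ| ≤ c`, where `0 < c < a`,
then `‖G w‖ ≤ M` on the sector region of opening `c`. [cite: OsterwalderSchraderCMP1975, Ch. VI.2 (6.15), (6.28)] -/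
theorem IsSectorData.norm_extension_le (h : IsSectorData a S E C₀ p Csec) (ha : a ≤ π / 2)
    {G : (Fin (m + 1) → ℂ) → ℂ} (hG : DifferentiableOn ℂ G (sectorRegion m a))
    (hGreal : ∀ u : Fin (m + 1) → ℝ, (∀ j, 0 < u j) → G (fun j => (u j : ℂ)) = S u)
    {c M : ℝ} (hc0 : 0 < c) (hca : c < a)
    (hMS : ∀ u : Fin (m + 1) → ℝ, (∀ j, 0 < u j) → ‖S u‖ ≤ M)
    (hME : ∀ (i : Fin (m + 1)) (u' : Fin m → ℝ) (τ : ℂ), (∀ j, 0 < u' j) → 0 < τ.re → |τ.arg| ≤ c →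
      ‖E i u' τ‖ ≤ M)
    {w : Fin (m + 1) → ℂ} (hw : w ∈ sectorRegion m c) : ‖G w‖ ≤ M := by
  by_contra hlt
  push Not at hlt
  set v : ℂ := G w with hv
  have hM0 : 0 ≤ M := (norm_nonneg _).trans (hMS (fun _ => 1) fun _ => one_pos)
  have hvM : 0 < ‖v‖ - M := sub_pos.2 hlt
  -- the data `1/(S - v)`, `1/(Eᵢ - v)` of opening `c`
  have hSne : ∀ u : Fin (m + 1) → ℝ, (∀ j, 0 < u j) → S u - v ≠ 0 := fun u hu hzero => by
    have : ‖S u‖ = ‖v‖ := by rw [sub_eq_zero.1 hzero]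
    linarith [hMS u hu]
  have hEne : ∀ (i : Fin (m + 1)) (u' : Fin m → ℝ) (τ : ℂ), (∀ j, 0 < u' j) → 0 < τ.re → |τ.arg| ≤ c →
      E i u' τ - v ≠ 0 := fun i u' τ hu hτ hτc hzero => by
    have : ‖E i u' τ‖ = ‖v‖ := by rw [sub_eq_zero.1 hzero]
    linarith [hME i u' τ hu hτ hτc]
  have hinv_le : ∀ z : ℂ, ‖z‖ ≤ M → ‖(z - v)⁻¹‖ ≤ (‖v‖ - M)⁻¹ := fun z hz => by
    rw [norm_inv]
    refine inv_anti₀ hvM ?_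
    calc ‖v‖ - M ≤ ‖v‖ - ‖z‖ := by linarith
      _ ≤ ‖z - v‖ := by rw [← norm_neg (z - v), neg_sub]; exact norm_sub_norm_le _ _
  have hcsec : openSector c ⊆ openSector a := fun τ hτ => ⟨hτ.1, hτ.2.trans hca⟩
  have hdata : IsSectorData c (fun u => (S u - v)⁻¹) (fun i u' τ => (E i u' τ - v)⁻¹)
      ((‖v‖ - M)⁻¹) 0 (fun _ => (‖v‖ - M)⁻¹) := by
    refine ⟨?_, by positivity, fun u hu => ?_, fun i τ hτ => ?_, fun i u' hu => ?_, fun _ => by positivity,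
      fun i c' hc' u' τ hu hτ hτc => ?_, fun i u' hu x hx => ?_⟩
    · exact (h.cont.sub continuousOn_const).inv₀ fun u hu => hSne u hu
    · rw [pow_zero, mul_one]; exact hinv_le _ (hMS u hu)
    · exact ((h.slot_cont i τ (hcsec hτ)).sub continuousOn_const).inv₀ fun u' hu' =>
        hEne i u' τ hu' hτ.1 hτ.2.le
    · exact (((h.slot_holo i u' hu).mono hcsec).sub (differentiableOn_const _)).inv fun τ hτ =>
        hEne i u' τ hu hτ.1 hτ.2.le
    · rw [pow_zero, pow_zero, mul_one, mul_one]
      exact hinv_le _ (hME i u' τ hu hτ (hτc.trans hc'.le))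
    · simp only [h.slot_real i u' hu x hx]
  obtain ⟨g, hgd, hgreal⟩ := hdata.exists_extension hc0 (hca.le.trans ha)
  -- `(G - v) g = 1` on the sector region of opening `c`
  have hGc : DifferentiableOn ℂ G (sectorRegion m c) := hG.mono fun ζ hζ => ⟨hζ.1, hζ.2.trans hca⟩
  have hP : EqOn (fun ζ => (G ζ - v) * g ζ) (fun _ => 1) (sectorRegion m c) := by
    refine eqOn_sectorRegion_of_eqOn_posReal hc0 (hca.le.trans ha)
      ((hGc.sub (differentiableOn_const _)).mul hgd) (differentiableOn_const _) fun η hη => ?_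
    show (G _ - v) * g _ = 1
    rw [hGreal η hη, hgreal η hη, mul_inv_cancel₀ (hSne η hη)]
  have h1 := hP hw
  simp only [hv, sub_self, zero_mul] at h1
  exact zero_ne_one h1

end Extension

end Literature.MathematicalPhysics.QuantumFieldTheory.LogSlot
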